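import Summits.HodgeConjecture.HodgeConjecture.Theorems.F0P2tLineFinCoeff                 -- ★ (N2) `integrable_finCoeff_lineThetaKernelDatum` (hF, T5 spelling)
import Summits.HodgeConjecture.HodgeConjecture.Theorems.H413E2RallisRankOneOfKernel       -- ★ `E2RallisRankOne.rallisRankOneContCM_of_kernelCM` (the CM Rallis letter ⟸ kernel form)
import Summits.HodgeConjecture.HodgeConjecture.Theorems.H413E2SWKernelRallisOfSiegelWeil   -- ★ `E2SiegelWeil.kernelRallisIdentityCM_of_siegelWeil`
import Summits.HodgeConjecture.HodgeConjecture.Theorems.H413E2SWSiegelWeilCMClosed        -- ★ `E2SWSiegelWeilCM.siegelWeil_weilRange_CM` (Siegel–Weil in Weil's range, CM)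
import Literature.NumberTheory.Automorphic.Liu2021.ThetaLiftFromLineL2Continuity           -- ★ (N1) `continuous_schwartzPairing_lineThetaKernelDatum_one` (hcoef, T5 spelling)
import Literature.NumberTheory.Automorphic.Liu2021.ThetaLiftFromLineMeets                  -- ★ `lineThetaKernelDatum`
import Literature.NumberTheory.Automorphic.Liu2021.ThetaLiftFromLineCharacters             -- ★ `adelic_JW_mul_comm`, `compactSpace_quotient_range_toAdelic_JW`
import Literature.NumberTheory.GelbartRogawski1991.UnitaryDualPairCompatibleSplittingL2Isometric  -- ★ `lintegral_enorm_sq_pairRep_eq_of_continuous` (hiso)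
import Literature.NumberTheory.Automorphic.AdelicUnitaryGroupDatum                         -- ★ Hausdorff ∕ second countable ∕ discrete rational ∕ locally compact
import Literature.NumberTheory.Automorphic.AdelicGroupDataCompactMeasure                   -- ★ `modularCharacter_eq_one_of_mem_center`
import Literature.NumberTheory.Automorphic.GLnAdelicIntegrationFactsProofs                 -- ★ `isMulRightInvariant_of_modularCharacterFun_eq_one`
import HarnessLib

/-!
# Crux `H413`, programme P2 — Θ-OCC-GEN road, brick (N3): RALLIS' INNER PRODUCT IDENTITY [Li1992, Thm 2.1 (26)] FOR THE T5 THETA DATUM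
# `lineThetaKernelDatum L N e₁ dV hdV hdV0 μ hμ a hρ` — HYPOTHESIS-FREE (no letter), from sign facts on `d_V`

Cell hodgecm-mathlib (D-0151), FLOOR 0, crux item H413 = stmt-HodgeConjecture-24833; programme P2, sub-line `Cruxes/H413/Lines/F0_P2OccFlatGeneral.lean`
(Θ-OCC-GEN, books #173).  Author F0P2-p06 (g8), (N)-half sub-share.  `--supports stmt-HodgeConjecture-24833`.  DEF-FREE, theorems only, no `sorry`.

THE POINT.  The CM-restricted Rallis letter ★ `Li1992.RallisInnerProductFormulaUnitaryDualPairRankOneContCM` is a THEOREM of the tree (E-2 road: ★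
`E2RallisRankOne.rallisRankOneContCM_of_kernelCM` ∘ ★ `E2SiegelWeil.kernelRallisIdentityCM_of_siegelWeil` ∘ ★ `E2SWSiegelWeilCM.siegelWeil_weilRange_CM`, as consumed by
★ `HCCMUnconditionalF0HoccOfP4.F0Hocc_holds`) and is GENERIC in the pair's Gram data `(J_V, J_W, T_V, T_W)` and in the compatible splitting `s`.  The P4 pin
instantiated it at the CHOSEN splitting `splittingOf hGR₀` (★ `ThetaNonvanishing.rallisInnerProductIdentity_pin_of_rankOneContCM`); THIS FILE instantiates it at the
CONSTRUCTED `μ`-splitting of the line in the T5 spelling — `s := chiSplittingLine … (toHeckeCharacter L μ) … (T_W a) … (J_W a) (JW_eq …)`, i.e. at ★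
`lineThetaKernelDatum L N e₁ dV hdV hdV0 μ hμ a hρ` (an `abbrev` of `thetaKernelDatum … s … hρ univ _`) — discharging the letter's side conditions by the (N)-bricks:
`hiso` ★ `lintegral_enorm_sq_pairRep_eq_of_continuous` (★ `continuous_chiSplittingLine`), `hF` ★ (N2) `integrable_finCoeff_lineThetaKernelDatum`, `hcoef` ★ (N1)
`continuous_schwartzPairing_lineThetaKernelDatum_one`, the J-E2-1 (β) structure of `U(J_W a)(𝔸)` (★ Hausdorff ∕ second countable ∕ discrete rationals of
`AdelicUnitaryGroupDatum`; right invariance of `dh` from commutativity ★ `adelic_JW_mul_comm` + ★ `modularCharacter_eq_one_of_mem_center`), `[U(J_W a)]` compact ★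
`compactSpace_quotient_range_toAdelic_JW`.  Inputs left to the caller: the sign facts `(ι₁, h₁V, hV)` on `d_V` (signature `(N−1,1)` up to orientation at `ι₁`, definite
elsewhere), ONE complex embedding `τ` with `diag d_V` positive definite through `τ` (any `τ` off the place of `ι₁` when `[L⁺:ℚ] ≥ 2`), `2 < N`, `3 ≤ n'`, Weil's
majorants `hρ` (★ (N0) `hasThetaMajorants_lineThetaKernelDatum` produces them from the same sign facts — kept a binder so that the conclusion is about the caller's
datum verbatim), and the four measures with the letter's requirements.

* **`rallisInnerProductIdentity_lineThetaKernelDatum`** — `(lineThetaKernelDatum L N e₁ dV hdV hdV0 μ hμ a hρ).RallisInnerProductIdentity (schwartzPairing L⁺ (Fin n') ν_X) dh μ_W ν`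
  for ANY additive Haar `ν_X` on `𝔸_{L⁺}^{n'}`, ANY Haar `dh` on `U(J_W a)(𝔸_{L⁺})`, ANY finite invariant open-positive Borel `μ_W`, `ν` on `[U(J_W a)]`, `[U(diag d_V)]`
  — the `hR` binder of ★ brick 7 `ThetaNonvanishing.thetaLift_charCM_tmul_ne_zero_of_finCoeff_ne_zero` at the T5 datum, token for token.

HONEST LABEL: HC_CM is proved only modulo the 2 remaining named inputs (hLiu418, h413) until rung 0 closes; this file asserts nothing of print — it is an
instantiation of theorems of the tree.

## References
* [Li1992] J.-S. Li, J. reine angew. Math. 428 (1992), Thm 2.1 (26) p. 184, p. 178.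
* [GelbartRogawski1991] S. Gelbart, J. Rogawski, Invent. Math. 105 (1991), §3.1 Prop. 3.1.1 p. 455, p. 454 L21–27.
* [Liu2021] Y. Liu, Camb. J. Math. 9 (2021) = arXiv:2102.11518, proof of Prop. 4.13 (l. 2145); App. D §D.1 Steps 1–2.
* [Weil1965] A. Weil, Acta Math. 113 (1965), Thm. 5 p. 76 (Siegel–Weil).  [GetzHahn2024] J. Getz, H. Hahn (2024), Lemma 3.5.4.
-/

set_option autoImplicit false
set_option linter.dupNamespace false

noncomputable section

open scoped ComplexConjugate Matrix ComplexOrder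
open MeasureTheory MeasureTheory.Measure NumberField IsDedekindDomain
open Literature.NumberTheory.Automorphic Literature.NumberTheory.Automorphic.UnitaryGroup
open Literature.NumberTheory.Automorphic.IdeleClassGroup
open Literature.NumberTheory.Automorphic.Liu2021 Literature.NumberTheory.Automorphic.Liu2021.Def411WeilCarriers
open Literature.NumberTheory.Automorphic.Liu2021.Def411WeilCarriersDoubling
open Literature.NumberTheory.Weil1964 Literature.NumberTheory.Li1992
open Literature.NumberTheory.GelbartRogawski1991 Literature.NumberTheory.GelbartRogawski1991.UnitaryDualPair
open Literature.NumberTheory.GelbartRogawski1991.UnitaryDualPair.WeilCoinv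
open Literature.NumberTheory.GaloisRepresentations (HeckeCharacter)
open Literature.RepresentationTheory.HarrisKudlaSweet1996 (IsSplittingChar)
open Literature.RepresentationTheory.Liu2021
open Summit.HodgeConjecture.HodgeConjecture.Cruxes.H413

namespace Summit.HodgeConjecture.HodgeConjecture.Cruxes.H413.F0P2tLineRallisIdentity

variable (L : Type) [Field L] [NumberField L] [IsCMField L] {N n' : ℕ} (e₁ : Fin N × Fin 1 ≃ Fin n')
  (dV : Fin N → L) (hdV : ∀ i, IsCMField.complexConj L (dV i) = dV i) (hdV0 : ∀ i, dV i ≠ 0)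
  (hN : 2 < N) (h3 : 3 ≤ n')
  (μH : Literature.NumberTheory.Automorphic.IdeleClassGroup L →ₜ* Circle) (hμ : IsConjugateSymplectic L μH)
  (a : (↥(maximalRealSubfield L))ˣ) (ι₁ : L →+* ℂ)
  (h₁V : ∃ i₀ : Fin N, (∀ i, i ≠ i₀ → 0 < (ι₁ (dV i)).re) ∨ ∀ i, i ≠ i₀ → (ι₁ (dV i)).re < 0)
  (hV : ∀ τ : L →+* ℂ, InfinitePlace.mk τ ≠ InfinitePlace.mk ι₁ → (∀ i, 0 < (τ (dV i)).re) ∨ ∀ i, (τ (dV i)).re < 0)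
  (τ : L →+* ℂ) (hτ : ((Matrix.diagonal dV).map τ).PosDef)
  (hρ : HasThetaMajorants fun
      (p : ↥(UnitaryGroup.adelic (↥(maximalRealSubfield L)) L (IsCMField.complexConj L) N (Matrix.diagonal dV)) ×
        ↥(UnitaryGroup.adelic (↥(maximalRealSubfield L)) L (IsCMField.complexConj L) 1 (JW (↥(maximalRealSubfield L)) L a)))
      (Φ : piSchwartzBruhat (↥(maximalRealSubfield L)) (Fin n')) =>
        pairRep (↥(maximalRealSubfield L)) L (IsCMField.complexConj L) N 1 e₁ (Matrix.diagonal dV) (JW (↥(maximalRealSubfield L)) L a)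
          (chiSplittingLine L e₁ dV hdV hdV0 (toHeckeCharacter L μH) (isUnitary_toHeckeCharacter L μH)
            ((isOscillatorChar_toHeckeCharacter_iff μH).mpr hμ) (TW (↥(maximalRealSubfield L)) a)
            (isUnit_det_TW (↥(maximalRealSubfield L)) a) (JW (↥(maximalRealSubfield L)) L a) (JW_eq (↥(maximalRealSubfield L)) L a))
          p Φ)
  -- the four measures of (26), with the letter's requirements on them
  [MeasurableSpace (AdeleRing (𝓞 ↥(maximalRealSubfield L)) ↥(maximalRealSubfield L))]
  [BorelSpace (AdeleRing (𝓞 ↥(maximalRealSubfield L)) ↥(maximalRealSubfield L))]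
  (νX : Measure (Fin n' → AdeleRing (𝓞 ↥(maximalRealSubfield L)) ↥(maximalRealSubfield L))) [νX.IsAddHaarMeasure]
  [MeasurableSpace ↥(UnitaryGroup.adelic (↥(maximalRealSubfield L)) L (IsCMField.complexConj L) 1 (JW (↥(maximalRealSubfield L)) L a))]
  [BorelSpace ↥(UnitaryGroup.adelic (↥(maximalRealSubfield L)) L (IsCMField.complexConj L) 1 (JW (↥(maximalRealSubfield L)) L a))]
  (dh : Measure ↥(UnitaryGroup.adelic (↥(maximalRealSubfield L)) L (IsCMField.complexConj L) 1 (JW (↥(maximalRealSubfield L)) L a)))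
  [dh.IsHaarMeasure]
  [CompactSpace (↥(UnitaryGroup.adelic (↥(maximalRealSubfield L)) L (IsCMField.complexConj L) N (Matrix.diagonal dV)) ⧸
    (UnitaryGroup.toAdelic (↥(maximalRealSubfield L)) L (IsCMField.complexConj L) N (Matrix.diagonal dV)).range)]
  [MeasurableSpace (↥(UnitaryGroup.adelic (↥(maximalRealSubfield L)) L (IsCMField.complexConj L) 1 (JW (↥(maximalRealSubfield L)) L a)) ⧸
    (UnitaryGroup.toAdelic (↥(maximalRealSubfield L)) L (IsCMField.complexConj L) 1 (JW (↥(maximalRealSubfield L)) L a)).range)]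
  [BorelSpace (↥(UnitaryGroup.adelic (↥(maximalRealSubfield L)) L (IsCMField.complexConj L) 1 (JW (↥(maximalRealSubfield L)) L a)) ⧸
    (UnitaryGroup.toAdelic (↥(maximalRealSubfield L)) L (IsCMField.complexConj L) 1 (JW (↥(maximalRealSubfield L)) L a)).range)]
  (μW : Measure (↥(UnitaryGroup.adelic (↥(maximalRealSubfield L)) L (IsCMField.complexConj L) 1 (JW (↥(maximalRealSubfield L)) L a)) ⧸
    (UnitaryGroup.toAdelic (↥(maximalRealSubfield L)) L (IsCMField.complexConj L) 1 (JW (↥(maximalRealSubfield L)) L a)).range))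
  [IsFiniteMeasure μW] [μW.IsOpenPosMeasure]
  [SMulInvariantMeasure ↥(UnitaryGroup.adelic (↥(maximalRealSubfield L)) L (IsCMField.complexConj L) 1 (JW (↥(maximalRealSubfield L)) L a))
    (↥(UnitaryGroup.adelic (↥(maximalRealSubfield L)) L (IsCMField.complexConj L) 1 (JW (↥(maximalRealSubfield L)) L a)) ⧸
      (UnitaryGroup.toAdelic (↥(maximalRealSubfield L)) L (IsCMField.complexConj L) 1 (JW (↥(maximalRealSubfield L)) L a)).range) μW]
  [MeasurableSpace (↥(UnitaryGroup.adelic (↥(maximalRealSubfield L)) L (IsCMField.complexConj L) N (Matrix.diagonal dV)) ⧸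
    (UnitaryGroup.toAdelic (↥(maximalRealSubfield L)) L (IsCMField.complexConj L) N (Matrix.diagonal dV)).range)]
  [BorelSpace (↥(UnitaryGroup.adelic (↥(maximalRealSubfield L)) L (IsCMField.complexConj L) N (Matrix.diagonal dV)) ⧸
    (UnitaryGroup.toAdelic (↥(maximalRealSubfield L)) L (IsCMField.complexConj L) N (Matrix.diagonal dV)).range)]
  (ν : Measure (↥(UnitaryGroup.adelic (↥(maximalRealSubfield L)) L (IsCMField.complexConj L) N (Matrix.diagonal dV)) ⧸
    (UnitaryGroup.toAdelic (↥(maximalRealSubfield L)) L (IsCMField.complexConj L) N (Matrix.diagonal dV)).range))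
  [IsFiniteMeasure ν] [ν.IsOpenPosMeasure]
  [SMulInvariantMeasure ↥(UnitaryGroup.adelic (↥(maximalRealSubfield L)) L (IsCMField.complexConj L) N (Matrix.diagonal dV))
    (↥(UnitaryGroup.adelic (↥(maximalRealSubfield L)) L (IsCMField.complexConj L) N (Matrix.diagonal dV)) ⧸
      (UnitaryGroup.toAdelic (↥(maximalRealSubfield L)) L (IsCMField.complexConj L) N (Matrix.diagonal dV)).range) ν]

set_option synthInstance.maxHeartbeats 400000 in
set_option maxHeartbeats 4000000 in
-- heartbeats: the letter's 40-binder telescope instantiated at the `splittingDatum` of the line (as in ★ `rallisInnerProductIdentity_cm_of_rankOneContCM`).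
include hN h3 ι₁ h₁V hV τ hτ in
/-- **RALLIS' IDENTITY (26) FOR THE T5 THETA DATUM OF THE LINE `⟨a⟩` AT THE `μ`-SPLITTING, HYPOTHESIS-FREE.**  For a CM field `L`, real non-zero `d_V : Fin N → L`
of signature `(N−1,1)` up to orientation through `ι₁` (`h₁V`) and definite through every other complex embedding (`hV`), positive definite through `τ` (`hτ`), `2 < N`,
`3 ≤ n'`, a conjugate-symplectic `μ`, a line scalar `a ∈ L⁺ˣ` and Weil's majorants `hρ`: for every additive Haar `ν_X`, Haar `dh`, and finite invariant open-positive Borel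
`μ_W`, `ν` on the two compact quotients, `(lineThetaKernelDatum L N e₁ dV hdV hdV0 μ hμ a hρ).RallisInnerProductIdentity (schwartzPairing L⁺ (Fin n') ν_X) dh μ_W ν` —
the CM Rallis letter (a ★ theorem over the Siegel–Weil road) at `s := chiSplittingLine …`, with `hiso`, `hF`, `hcoef` and the J-E2-1 (β) structure discharged by ★ bricks.
[cite: Li1992, Thm 2.1 (26) p. 184] [cite: GelbartRogawski1991, §3.1 Prop. 3.1.1 p. 455 L1–3, p. 454 L21–27] [cite: Liu2021, proof of Prop. 4.13 (l. 2145)] -/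
theorem rallisInnerProductIdentity_lineThetaKernelDatum :
    (lineThetaKernelDatum L N e₁ dV hdV hdV0 μH hμ a hρ).RallisInnerProductIdentity
      (schwartzPairing (↥(maximalRealSubfield L)) (Fin n') νX) dh μW ν := by
  haveI : T2Space ↥(UnitaryGroup.adelic (↥(maximalRealSubfield L)) L (IsCMField.complexConj L) 1 (JW (↥(maximalRealSubfield L)) L a)) :=
    UnitaryGroup.t2Space_cmDatum_Adelic L 1 (JW (↥(maximalRealSubfield L)) L a)
  haveI : SecondCountableTopology ↥(UnitaryGroup.adelic (↥(maximalRealSubfield L)) L (IsCMField.complexConj L) 1 (JW (↥(maximalRealSubfield L)) L a)) :=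
    UnitaryGroup.secondCountableTopology_cmDatum_Adelic L 1 (JW (↥(maximalRealSubfield L)) L a)
  haveI : DiscreteTopology ↥(UnitaryGroup.toAdelic (↥(maximalRealSubfield L)) L (IsCMField.complexConj L) 1 (JW (↥(maximalRealSubfield L)) L a)).range :=
    UnitaryGroup.adelicGroupData_isDiscreteRational L 1 (JW (↥(maximalRealSubfield L)) L a)
  haveI : dh.IsMulRightInvariant :=
    isMulRightInvariant_of_modularCharacterFun_eq_one
      (fun g => modularCharacter_eq_one_of_mem_center (Subgroup.mem_center_iff.2 fun h => adelic_JW_mul_comm L a h g)) dh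
  haveI : LocallyCompactSpace ↥(UnitaryGroup.adelic (↥(maximalRealSubfield L)) L (IsCMField.complexConj L) N (Matrix.diagonal dV)) :=
    UnitaryGroup.locallyCompactSpace_cmDatum_Adelic L N (Matrix.diagonal dV)
  haveI : LocallyCompactSpace ↥(UnitaryGroup.adelic (↥(maximalRealSubfield L)) L (IsCMField.complexConj L) 1 (JW (↥(maximalRealSubfield L)) L a)) :=
    UnitaryGroup.locallyCompactSpace_cmDatum_Adelic L 1 (JW (↥(maximalRealSubfield L)) L a)
  haveI : CompactSpace (↥(UnitaryGroup.adelic (↥(maximalRealSubfield L)) L (IsCMField.complexConj L) 1 (JW (↥(maximalRealSubfield L)) L a)) ⧸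
      (UnitaryGroup.toAdelic (↥(maximalRealSubfield L)) L (IsCMField.complexConj L) 1 (JW (↥(maximalRealSubfield L)) L a)).range) :=
    compactSpace_quotient_range_toAdelic_JW L a
  exact (E2RallisRankOne.rallisRankOneContCM_of_kernelCM
      (E2SiegelWeil.kernelRallisIdentityCM_of_siegelWeil E2SWSiegelWeilCM.siegelWeil_weilRange_CM))
    (↥(maximalRealSubfield L)) L (IsCMField.complexConj L) N e₁ (Matrix.diagonal dV) (JW (↥(maximalRealSubfield L)) L a) τ hτ
    (complexConj_imagUnit L) (imagUnit_ne_zero L) (imagUnit_mul_self L) (realDiagonal_isSymm L dV hdV) (isSymm_TW (↥(maximalRealSubfield L)) a)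
    (isUnit_det_realDiagonal L dV hdV hdV0) (isUnit_det_TW (↥(maximalRealSubfield L)) a) (realDiagonal_map L dV hdV).symm
    (JW_eq (↥(maximalRealSubfield L)) L a)
    (chiSplittingLine L e₁ dV hdV hdV0 (toHeckeCharacter L μH) (isUnitary_toHeckeCharacter L μH)
      ((isOscillatorChar_toHeckeCharacter_iff μH).mpr hμ) (TW (↥(maximalRealSubfield L)) a)
      (isUnit_det_TW (↥(maximalRealSubfield L)) a) (JW (↥(maximalRealSubfield L)) L a) (JW_eq (↥(maximalRealSubfield L)) L a))
    (isCompatible_chiSplittingLine L e₁ dV hdV hdV0 (toHeckeCharacter L μH) (isUnitary_toHeckeCharacter L μH)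
      ((isOscillatorChar_toHeckeCharacter_iff μH).mpr hμ) (TW (↥(maximalRealSubfield L)) a) (isSymm_TW (↥(maximalRealSubfield L)) a)
      (isUnit_det_TW (↥(maximalRealSubfield L)) a) (JW (↥(maximalRealSubfield L)) L a) (JW_eq (↥(maximalRealSubfield L)) L a))
    hρ Set.univ (fun _ _ _ => Set.mem_univ _) νX dh μW ν
    (lintegral_enorm_sq_pairRep_eq_of_continuous _ _ _ _ _ _ _ _ _ _ _ _ _ _ _ _ _ νX _
      (isCompatible_chiSplittingLine L e₁ dV hdV hdV0 (toHeckeCharacter L μH) (isUnitary_toHeckeCharacter L μH)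
        ((isOscillatorChar_toHeckeCharacter_iff μH).mpr hμ) (TW (↥(maximalRealSubfield L)) a) (isSymm_TW (↥(maximalRealSubfield L)) a)
        (isUnit_det_TW (↥(maximalRealSubfield L)) a) (JW (↥(maximalRealSubfield L)) L a) (JW_eq (↥(maximalRealSubfield L)) L a))
      (continuous_chiSplittingLine L e₁ dV hdV hdV0 (toHeckeCharacter L μH) (isUnitary_toHeckeCharacter L μH)
        ((isOscillatorChar_toHeckeCharacter_iff μH).mpr hμ) (TW (↥(maximalRealSubfield L)) a)
        (isUnit_det_TW (↥(maximalRealSubfield L)) a) (JW (↥(maximalRealSubfield L)) L a) (JW_eq (↥(maximalRealSubfield L)) L a)))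
    (fun μf _ _ _ μb _ Φf Ψf => F0P2tLineFinCoeff.integrable_finCoeff_lineThetaKernelDatum L e₁ dV hdV hdV0 h3 μf a μb μH hμ Φf Ψf)
    (continuous_schwartzPairing_lineThetaKernelDatum_one L e₁ dV hdV hdV0 νX μH hμ a ι₁ h₁V hV) hN

end Summit.HodgeConjecture.HodgeConjecture.Cruxes.H413.F0P2tLineRallisIdentity

end
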